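import Mathlib.Geometry.Manifold.LocalDiffeomorph
import Literature.Geometry.Riemannian.RicciFlowMaximal
import Literature.Geometry.Riemannian.CurvatureNormSq
import Literature.Geometry.Riemannian.ChangGurskyYangProofs
import HarnessLib

/-!
# The blow-up limit at a finite-time singularity of the Ricci flow on a closed manifold
(topic `Geometry/Riemannian`; named fact, wanted by the crux `ChangGurskyYang` of route
`SmoothPoincare4/EntropyRung`, item stmt-SmoothPoincare4-10834, line `margerin-cone-hamilton-rails`,
where it replaces the bespoke convergence criterion `hamilton_convergenceCriterion_four` as the one
analytic leaf of Margerin's flow endgame)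

## The result

Topping 2006, §8.5, Thm. 8.5.1 ("blowing up at singularities"; the argument of Hamilton 1995
[Hamilton1995, §16] made unconditional by Perelman's no local collapsing): let `M` be a closed manifold
and `g(t)` a Ricci flow on a maximal time interval `[0, T)` with `T < ∞`. Then there exist points
`pᵢ ∈ M` and times `tᵢ ↑ T` with `|Rm|(pᵢ, tᵢ) = sup_{x ∈ M, t ∈ [0, tᵢ]} |Rm|(x, t) → ∞` such that the
rescaled Ricci flows `gᵢ(t) := |Rm|(pᵢ, tᵢ) · g(tᵢ + t / |Rm|(pᵢ, tᵢ))` converge, in the smooth pointed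
(Cheeger–Gromov) sense `(M, gᵢ(t), pᵢ) → (N, ĝ(t), p_∞)`, to a complete Ricci flow on `(−∞, 0]` with
bounded curvature and `|Rm(ĝ(0))|(p_∞) = 1`. Its printed proof assembles: curvature blow-up at a
finite maximal time (Topping Thm. 5.3.1; tree: `ricciFlow_curvature_blowup_of_shortTime
ricciFlow_shortTime_existence_holds`), the point picking (Topping §7.3), no local collapsing
(Perelman 2002, Thm. 4.1; tree: `perelman_noLocalCollapsing_holds`), volume ratio ⇒ injectivity radius
(Cheeger–Gromov–Taylor 1982, Thm. 4.7; Topping §8.4), Shi's global derivative estimates (tree: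
`IsRicciFlow.curvDerivNormSq_le_of_curvatureBoundedBy`) and Hamilton's compactness theorem for flows /
manifolds (Hamilton 1995 [Hamilton1995Compactness], Thm. 1.2 / Thm. 2.3; Morgan–Tian 2007, Thm. 5.9,
Cor. 5.10, Thm. 5.15), the notion of convergence being the pointed `C^∞_loc` one (Morgan–Tian 2007,
Def. 5.3; Petersen 2006, Ch. 10, §3.2).

## Vended form (`ricciFlow_blowupLimit_four`)

The special case and the consequences the consumer needs, over the tree's vocabulary: dimension four,
model `ℝ⁴` (`𝓡 4`), `M` compact connected Hausdorff second countable, `(g, cov)` a maximal Ricci flow of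
Riemannian metrics on `[0, T)` (`IsMaximalRicciFlow`, `RicciFlowMaximal.lean`; `T : ℝ`, so finite);
`|Rm|²` is the full contraction `Σ Rm_{ijkl}²` (`PseudoRiemannianMetric.curvNormSqWith`,
`CurvatureNormSq.lean`, Topping (3.2.4)). CONCLUSION: sequences `p : ℕ → M`, `t : ℕ → ℝ`,
`Q : ℕ → ℝ` with `tₙ ∈ [0, T)`, `tₙ → T`, `Qₙ > 0`, `Qₙ → ∞`, `|Rm|²(pₙ, tₙ) = Qₙ²` maximal over
`M × [0, tₙ]` (Topping's point picking), and — of the limit flow — only its TIME-ZERO SLICE: a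
connected Hausdorff second-countable `C^∞` 4-manifold `N` on `ℝ⁴`, a `C^∞` Riemannian metric `h` on
`N` with (its) Levi-Civita connection geodesically complete (`IsGeodesicallyComplete h.leviCivita`), a
base point `p_∞`, and the data of Morgan–Tian Def. 5.3 in diagonalised form — an increasing exhaustion
`U 0 ⊆ U 1 ⊆ ⋯` of `N` by open sets containing `p_∞`, comparison maps `φₙ : N → M` (total functions,
meaningful on `U n`) which are injective `C^∞` local diffeomorphisms ON `U n` (Mathlib
`IsLocalDiffeomorphOn`, `Set.InjOn`; i.e. open embeddings `U n ↪ M`, Morgan–Tian's `φₖ : V_k → U_k`)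
sending `p_∞ ↦ pₙ` — together with the following CONSEQUENCES of `φₙ^*(Qₙ g(tₙ)) → h` in `C^∞_loc`:
(i) `C⁰` convergence on pushed-forward vectors, `Qₙ · g(tₙ)(dφₙ v, dφₙ w) → h(v, w)`;
(ii) pointwise convergence along `φₙ` of the rescaled curvature invariants the tree names —
`Qₙ⁻¹ R` (`scalarCurvatureWith`), `Qₙ⁻² |Rm|²` (`curvNormSqWith`), `Qₙ⁻² |W|²` (`weylNormSq`),
`Qₙ⁻² |E|²` (`tracelessRicciNormSq`) — to `R_h`, `|Rm_h|²`, `|W_h|²`, `|E_h|²` (each is a natural,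
`C²`-continuous function of the metric: `R(φ^*g) = R(g) ∘ φ` etc., O'Neill 1983, Prop. 3.59, tree
`scalarCurvature_comap`), and (iii) the normalisation `|Rm_h|²(p_∞) = 1`. The conclusion is an honest
WEAKENING of the printed one (no later times of the limit flow, no covering clause
`φₙ(U n) ⊇ B(pₙ, R)`, no `Cᵏ` norms of components in charts — the Lorentzian analogue
`Spacetime.LocalSubconvergence` of `Lorentzian/SpacetimeLocalConvergence.lean` shows how those would be
typed); the consumer (`Summits/SmoothPoincare4/…/Cruxes/ChangGurskyYang/Lines/margerin_cone_hamilton_rails.lean`,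
stubs `stub_limitRound` / `stub_roundRecognition` / `stub_transfer`) needs exactly (ii), (iii),
completeness, connectedness and the embedding data.

## Design notes (for the reviewer)

* The hypothesis is only `IsMaximalRicciFlow g cov T` on a closed connected 4-manifold: finiteness of
  `T` is built into that structure (`T : ℝ`), and the blow-up of `|Rm|` is a CONSEQUENCE (Topping
  Thm. 5.3.1), not a hypothesis — exactly as in Topping Thm. 8.5.1.
* Non-vacuity / junk audit: `M` is nonempty (`ConnectedSpace`); `Qₙ > 0` is stated (a flat initial
  metric is static and immortal by `ricciFlow_uniqueness_holds`, so `max |Rm|² > 0` eventually; the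
  fact only asserts the EXISTENCE of suitable `pₙ, tₙ`); `curvNormSqWith ≥ 0` for Riemannian metrics
  (`curvNormSqWith_nonneg`); the instances of the limit are existentially bound in the order Lean needs
  them; `N` is nonempty (`p_∞`). Scaling conventions: under `g ↦ Q g` one has `R ↦ Q⁻¹R`,
  `|Rm|², |W|², |E|² ↦ Q⁻²·` (`scalarCurvature_constSmul`, `weylNormSq_constSmul`,
  `tracelessRicciNormSq_constSmul`), which is what the factors `Qₙ⁻¹`, `Qₙ⁻¹ ^ 2` encode without
  forming the rescaled metric.
* `(g (t n)).weylNormSq` needs the `HasLeviCivita` instance of the smooth metric `g (t n)`, supplied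
  inline by the tree theorem `PseudoRiemannianMetric.hasLeviCivita` (`haveI`).
-- TODO(general form): every dimension `n ≥ 2` and model space; the limit as a complete ancient Ricci
-- FLOW `(N, ĝ(t))_{t ≤ 0}` with bounded curvature, `κ`-noncollapsed on all scales, with full `Cᵏ_loc`
-- convergence of `φₙ^* gₙ(t)` on compact subsets of `N × (−∞, 0]` and the covering clause (Topping
-- 2006, Thm. 8.5.1; Morgan–Tian 2007, Def. 5.3 (2b), Thm. 5.15); and the two compactness theorems
-- themselves (Hamilton 1995, Thm. 1.2 and Thm. 2.3 = Morgan–Tian Thm. 5.9 / Cor. 5.10 / Thm. 5.15) as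
-- separate named facts from which this one follows over the tree's `perelman_noLocalCollapsing_holds`,
-- `IsKappaNoncollapsed.parabolicRescale`, `IsRicciFlow.curvDerivNormSq_le_of_curvatureBoundedBy` and
-- `ricciFlow_curvature_blowup_of_shortTime`.

## References

* [Topping2006] P. Topping, *Lectures on the Ricci flow*, LMS Lecture Note Series 325, CUP 2006,
  §5.3 Thm. 5.3.1, §7.1–§7.3, §8.3 Thm. 8.3.1, §8.4, §8.5 Thm. 8.5.1.
* [Hamilton1995Compactness] R. S. Hamilton, *A compactness property for solutions of the Ricci flow*,
  Amer. J. Math. 117 (1995) 545–572, Thm. 1.2, Thm. 2.3.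
* [Hamilton1995] R. S. Hamilton, *The formation of singularities in the Ricci flow*, Surveys in
  Differential Geometry II (1995) 7–136, §16.
* [Perelman2002] G. Perelman, *The entropy formula for the Ricci flow and its geometric applications*,
  arXiv:math/0211159, §4, Thm. 4.1.
* [MorganTian2007] J. Morgan, G. Tian, *Ricci Flow and the Poincaré Conjecture*, Clay Math. Monographs 3
  (2007) = arXiv:math/0607607, Ch. 5: Def. 5.3, Thm. 5.9, Cor. 5.10, Thm. 5.15 (page-read 2026-08-16).
* [CheegerGromovTaylor1982] J. Cheeger, M. Gromov, M. Taylor, J. Differential Geom. 17 (1982) 15–53,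
  Thm. 4.7.
* [Petersen2006] P. Petersen, *Riemannian Geometry*, 2nd ed., GTM 171 (2006), Ch. 10, §3.2.
* [ONeill1983] B. O'Neill, *Semi-Riemannian geometry* (1983), Ch. 3, Prop. 3.59.
-/

noncomputable section

open Set Function Filter
open scoped Manifold ContDiff Topology

namespace Literature.Geometry.Riemannian

open Literature.Geometry.Lorentzian Literature.Geometry.Lorentzian.PseudoRiemannianMetric

/-- NAMED FACT (**Topping 2006, §8.5, Thm. 8.5.1**, "blowing up at singularities": for a Ricci flow
`g(t)` on a closed manifold on a maximal time interval `[0, T)`, `T < ∞`, there are `pᵢ ∈ M`, `tᵢ ↑ T`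
with `|Rm|(pᵢ,tᵢ) = sup_{M×[0,tᵢ]} |Rm| → ∞` such that the rescalings
`gᵢ(t) = |Rm|(pᵢ,tᵢ) g(tᵢ + t/|Rm|(pᵢ,tᵢ))` converge in the smooth pointed Cheeger–Gromov sense to a
complete Ricci flow `(N, ĝ(t), p_∞)`, `t ≤ 0`, with `|Rm(ĝ(0))|(p_∞) = 1`; = Hamilton 1995
[Hamilton1995, §16] + Hamilton's compactness theorem [Hamilton1995Compactness, Thm. 1.2] + Perelman
2002, Thm. 4.1 + Cheeger–Gromov–Taylor 1982, Thm. 4.7; convergence notion: Morgan–Tian 2007,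
Def. 5.3). **Vended form** (module docstring): dimension `4`, model `ℝ⁴`, closed connected `M`, a
maximal Ricci flow of Riemannian metrics `(g, cov)` on `[0, T)` (`IsMaximalRicciFlow`); conclusion =
Topping's point picking (`Qₙ² = |Rm|²(pₙ,tₙ) = max_{M×[0,tₙ]} |Rm|²`, `|Rm|² = curvNormSqWith`,
`tₙ → T`, `Qₙ → ∞`) and the TIME-ZERO SLICE of the limit: a complete connected Riemannian 4-manifold
`(N, h, p_∞)`, an increasing open exhaustion `U` of `N` with `p_∞ ∈ U 0`, comparison maps
`φₙ : N → M` that are injective `C^∞` local diffeomorphisms on `U n` with `φₙ p_∞ = pₙ`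
(Morgan–Tian Def. 5.3, diagonalised), the `C⁰` convergence of `Qₙ · φₙ^* g(tₙ)` to `h` on tangent
vectors, the pointwise convergence along `φₙ` of the rescaled invariants `Qₙ⁻¹R`, `Qₙ⁻²|Rm|²`,
`Qₙ⁻²|W|²`, `Qₙ⁻²|E|²` of `g(tₙ)` to `R_h`, `|Rm_h|²`, `|W_h|²`, `|E_h|²`, and `|Rm_h|²(p_∞) = 1`.
Users take `(h : ricciFlow_blowupLimit_four)`.
[cite: Topping2006, §8.5, Thm. 8.5.1] -/
def ricciFlow_blowupLimit_four : Prop :=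
  ∀ (M : Type) [TopologicalSpace M] [T2Space M] [SecondCountableTopology M]
    [ChartedSpace (EuclideanSpace ℝ (Fin 4)) M]
    [IsManifold (modelWithCornersSelf ℝ (EuclideanSpace ℝ (Fin 4))) ((⊤ : ℕ∞) : WithTop ℕ∞) M]
    [CompactSpace M] [ConnectedSpace M]
    (g : ℝ → PseudoRiemannianMetric (modelWithCornersSelf ℝ (EuclideanSpace ℝ (Fin 4)))
      ((⊤ : ℕ∞) : WithTop ℕ∞) (EuclideanSpace ℝ (Fin 4))
      (TangentSpace (modelWithCornersSelf ℝ (EuclideanSpace ℝ (Fin 4))) : M → Type _))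
    (cov : ℝ → CovariantDerivative (modelWithCornersSelf ℝ (EuclideanSpace ℝ (Fin 4)))
      (EuclideanSpace ℝ (Fin 4))
      (TangentSpace (modelWithCornersSelf ℝ (EuclideanSpace ℝ (Fin 4))) : M → Type _))
    (T : ℝ), IsMaximalRicciFlow g cov T →
    ∃ (p : ℕ → M) (t : ℕ → ℝ) (Q : ℕ → ℝ),
      -- Topping's point picking: `Qₙ² = |Rm|²(pₙ, tₙ) = max_{M × [0, tₙ]} |Rm|²`, `tₙ → T`, `Qₙ → ∞`
      (∀ n, t n ∈ Ico 0 T) ∧ Tendsto t atTop (𝓝 T) ∧ (∀ n, 0 < Q n) ∧ Tendsto Q atTop atTop ∧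
      (∀ n, (g (t n)).curvNormSqWith (cov (t n)) (p n) = Q n ^ 2) ∧
      (∀ n, ∀ s ∈ Icc 0 (t n), ∀ x : M, (g s).curvNormSqWith (cov s) x ≤ Q n ^ 2) ∧
      -- the pointed limit of the rescaled slices `(M, Qₙ g(tₙ), pₙ)` (Morgan–Tian 2007, Def. 5.3)
      ∃ (N : Type) (_ : TopologicalSpace N) (_ : T2Space N) (_ : SecondCountableTopology N)
        (_ : ChartedSpace (EuclideanSpace ℝ (Fin 4)) N)
        (_ : IsManifold (modelWithCornersSelf ℝ (EuclideanSpace ℝ (Fin 4))) ((⊤ : ℕ∞) : WithTop ℕ∞) N)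
        (_ : ConnectedSpace N)
        (h : PseudoRiemannianMetric (modelWithCornersSelf ℝ (EuclideanSpace ℝ (Fin 4)))
          ((⊤ : ℕ∞) : WithTop ℕ∞) (EuclideanSpace ℝ (Fin 4))
          (TangentSpace (modelWithCornersSelf ℝ (EuclideanSpace ℝ (Fin 4))) : N → Type _))
        (_ : h.HasLeviCivita) (_ : h.IsRiemannian) (pinf : N) (U : ℕ → Set N) (φ : ℕ → N → M),
        IsGeodesicallyComplete h.leviCivita ∧
        (∀ n, IsOpen (U n)) ∧ Monotone U ∧ pinf ∈ U 0 ∧ (⋃ n, U n) = univ ∧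
        (∀ n, IsLocalDiffeomorphOn (modelWithCornersSelf ℝ (EuclideanSpace ℝ (Fin 4)))
          (modelWithCornersSelf ℝ (EuclideanSpace ℝ (Fin 4))) ((⊤ : ℕ∞) : WithTop ℕ∞) (φ n) (U n)) ∧
        (∀ n, InjOn (φ n) (U n)) ∧
        (∀ n, φ n pinf = p n) ∧
        h.curvNormSqWith h.leviCivita pinf = 1 ∧
        (∀ (y : N) (v w : TangentSpace (modelWithCornersSelf ℝ (EuclideanSpace ℝ (Fin 4))) y),
          Tendsto (fun n ↦ Q n * (g (t n)).val (φ n y)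
            (mfderiv (modelWithCornersSelf ℝ (EuclideanSpace ℝ (Fin 4)))
              (modelWithCornersSelf ℝ (EuclideanSpace ℝ (Fin 4))) (φ n) y v)
            (mfderiv (modelWithCornersSelf ℝ (EuclideanSpace ℝ (Fin 4)))
              (modelWithCornersSelf ℝ (EuclideanSpace ℝ (Fin 4))) (φ n) y w)) atTop (𝓝 (h.val y v w))) ∧
        (∀ y : N, Tendsto (fun n ↦ (Q n)⁻¹ * (g (t n)).scalarCurvatureWith (cov (t n)) (φ n y))
          atTop (𝓝 (h.scalarCurvature y))) ∧
        (∀ y : N, Tendsto (fun n ↦ (Q n)⁻¹ ^ 2 * (g (t n)).curvNormSqWith (cov (t n)) (φ n y))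
          atTop (𝓝 (h.curvNormSqWith h.leviCivita y))) ∧
        (∀ y : N, Tendsto (fun n ↦ haveI := (g (t n)).hasLeviCivita
            (Q n)⁻¹ ^ 2 * (g (t n)).weylNormSq (φ n y)) atTop (𝓝 (h.weylNormSq y))) ∧
        (∀ y : N, Tendsto (fun n ↦ haveI := (g (t n)).hasLeviCivita
            (Q n)⁻¹ ^ 2 * (g (t n)).tracelessRicciNormSq (φ n y)) atTop
          (𝓝 (h.tracelessRicciNormSq y)))

end Literature.Geometry.Riemannian

end
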